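import Literature.NumberTheory.GaloisRepresentations.GaloisCohomologyLayerInflationDelta
import Literature.NumberTheory.GaloisRepresentations.IdeleClassBarPresentationBoundary
import Literature.NumberTheory.GaloisRepresentations.PresentationGaloisModules
import Literature.NumberTheory.GaloisRepresentations.PresentationOfFiniteGaloisModule
import Mathlib.Algebra.Homology.HomologySequenceLemmas
import HarnessLib

/-!
# Door-c4's `U_E`-layers of the presentation vs. the `LayerDelta` layers: transport of layer classes and
# `δ₁^K (inf_E c) = inf_E (δ_layer c)` in door-c4's currency (Serre CG I §2.2 Prop. 8; NSW (1.5.1))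

Topic `NumberTheory/GaloisRepresentations`; namespace `Literature.NumberTheory.GaloisRepresentations.LayerDelta`.
Definitions with bodies (a group isomorphism, two module transports, two cohomology transports) and theorems; no
named fact, no instance, no notation, no `sorry`.  Cell `bsd-schneider-ideate`, seat door-c6 gen 18, Route A of crux
`AnticycControlAdditiveK` (item 19295): step (d) of the E-side of the reciprocity sum (memos/FINDING-door-c6-g17.md §2).

Two presentations of the layer group of a finite Galois layer `E ⊆ K̄` (`E : GalLayer K`) are in use:
door-c4/door-c5's `Γ_K ⧸ U_E` (`U_E = E.openNormalSubgroup = E.fixingSubgroup`, the currency of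
`invariantsQuotFunctor`, `LayerColimit.inflG`, `layerCohomologyIso`, `classBarInv_inflG_comp_boundary_presentation_idele`)
and `Γ_K ⧸ Γ_E` with `Γ_E = absGaloisFixingSubgroup E` a KERNEL (the currency of `absGaloisLayerRep`, `infOneLayer`,
`infTwo`, `LayerDelta.layerComplex` and (N2) `infTwo_δ_eq_δ₁_infOneLayer`).  The two subgroups are equal
(`absGaloisFixingSubgroup_eq_coe_openNormalSubgroup`) but not definitionally, so layer classes must be transported
(the instances `Normal K E` / `FiniteDimensional K E` of a layer are taken as hypotheses; discharge them with
`normal_layer E` / `finiteDimensional_layer E` through `haveI`):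

* `quotEquivAbs E : Γ_K ⧸ Γ_E ≃* Γ_K ⧸ U_E` (identity on representatives);
* `toAbsLayerHom E X` / `toAbsLayerHomOf E ρ` — the identity of underlying vectors as a morphism
  `Res (X^{U_E}) ⟶ (toDGM X)^{Γ_E}` (resp. `Res (M^{U_E}) ⟶ M^{Γ_E}` for `X = ofDiscreteGaloisModule ρ`);
* `toAbsLayer E X n`, `toAbsLayerOf E ρ n` — the induced maps `Hⁿ(Γ_K ⧸ U_E, X^{U_E}) → Hⁿ(Γ_K ⧸ Γ_E, X^{Γ_E})`
  (Mathlib `groupCohomology.map`), with cocycle formulas in degrees `1`, `2`;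
* **`toAbsLayer_δ`** — for the canonical presentation `S = presentationComplex ρ` and a layer `E ⊇ K(M)`:
  `toAbsLayer E S.X₁ 2 (δ_{S^{U_E}} c) = δ_{layerComplex} (toAbsLayerOf E ρ 1 c)` (naturality of Mathlib's connecting map
  under the morphism of short exact sequences of cochain complexes induced by the transports);
* **`δ₁_infOneLayer_toAbsLayerOf`** — `(pres_isSES ρ).δ₁ (infOneLayer K E ρ (toAbsLayerOf E ρ 1 c)) =
  infTwo K E (presModule₁ ρ) (toAbsLayer E S.X₁ 2 (δ_{S^{U_E}} c))`: (N2) read in door-c4's currency.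

HONEST FRAMING: bookkeeping; no arithmetic, no case of BSD or of Poitou–Tate.

## References
* J.-P. Serre, *Galois Cohomology* (1997), I §2.2 Proposition 8. [SerreGaloisCohomology1997]
* J. Neukirch, A. Schmidt, K. Wingberg, *Cohomology of Number Fields* (2nd ed. 2008), (1.5.1). [NeukirchSchmidtWingberg2008]
-/

noncomputable section

open CategoryTheory groupCohomology Field Literature.Algebra.Homology Literature.Algebra.Homology.DiscreteRep
open scoped ContRepresentation

namespace Literature.NumberTheory.GaloisRepresentations

namespace LayerDelta

open IdeleClassBar DGMBridge FreePresentation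

variable {K : Type} [Field K]

/-! ## §1. The two presentations of the layer group -/

/-- A layer is normal over `K` (`GalLayer.isGalois`; supply it with `haveI := normal_layer E`).
[cite: SerreGaloisCohomology1997, I §2.2] -/
theorem normal_layer (E : GalLayer K) : Normal K E.1 := by
  haveI := E.isGalois
  infer_instance

/-- A layer is finite over `K` (`GalLayer.finiteDimensional`; supply it with `haveI := finiteDimensional_layer E`).
[cite: SerreGaloisCohomology1997, I §2.2] -/
theorem finiteDimensional_layer (E : GalLayer K) : FiniteDimensional K E.1 := E.finiteDimensional

section Group

variable (E : GalLayer K) [Normal K E.1]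

/-- **`Γ_E = U_E`**: the kernel `absGaloisFixingSubgroup E` of `σ ↦ σ|_E` is door-c4's `E.openNormalSubgroup`
(`= E.fixingSubgroup`). [cite: SerreGaloisCohomology1997, I §2.2] -/
theorem absGaloisFixingSubgroup_eq_coe_openNormalSubgroup :
    absGaloisFixingSubgroup E.1 = (E.openNormalSubgroup : Subgroup (absoluteGaloisGroup K)) := by
  ext σ
  rw [← GalLayer.restrictHom_eq_one_iff]
  exact Iff.rfl

/-- Membership transfer `U_E → Γ_E`. [cite: SerreGaloisCohomology1997, I §2.2] -/
theorem mem_absGaloisFixingSubgroup_of_mem {σ : absoluteGaloisGroup K}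
    (hσ : σ ∈ (E.openNormalSubgroup : Subgroup (absoluteGaloisGroup K))) : σ ∈ absGaloisFixingSubgroup E.1 := by
  rw [absGaloisFixingSubgroup_eq_coe_openNormalSubgroup]; exact hσ

/-- Membership transfer `Γ_E → U_E`. [cite: SerreGaloisCohomology1997, I §2.2] -/
theorem mem_coe_openNormalSubgroup_of_mem {σ : absoluteGaloisGroup K}
    (hσ : σ ∈ absGaloisFixingSubgroup E.1) : σ ∈ (E.openNormalSubgroup : Subgroup (absoluteGaloisGroup K)) := by
  rw [← absGaloisFixingSubgroup_eq_coe_openNormalSubgroup]; exact hσ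

/-- **`Γ_K ⧸ Γ_E ≃* Γ_K ⧸ U_E`**, the identity on representatives. [cite: SerreGaloisCohomology1997, I §2.2] -/
def quotEquivAbs :
    absoluteGaloisGroup K ⧸ absGaloisFixingSubgroup E.1 ≃*
      absoluteGaloisGroup K ⧸ (E.openNormalSubgroup : Subgroup (absoluteGaloisGroup K)) :=
  QuotientGroup.quotientMulEquivOfEq (absGaloisFixingSubgroup_eq_coe_openNormalSubgroup E)

/-- `quotEquivAbs E [σ] = [σ]`. [cite: SerreGaloisCohomology1997, I §2.2] -/
@[simp] theorem quotEquivAbs_mk (σ : absoluteGaloisGroup K) :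
    quotEquivAbs E (QuotientGroup.mk σ) = QuotientGroup.mk σ :=
  rfl

end Group

/-! ## §2. Transport of the layer modules and of their cohomology -/

section Transport

variable (E : GalLayer K) [Normal K E.1] (X : DiscreteRepCat ℤ (absoluteGaloisGroup K))

/-- The underlying additive map `X^{U_E} → (toDGM X)^{Γ_E}` (identity of vectors). [cite: SerreGaloisCohomology1997, I §2.2] -/
def toAbsLayerAddHom :
    ((invariantsQuotFunctor ℤ (E.openNormalSubgroup : Subgroup (absoluteGaloisGroup K))).obj X).V →+
      (absGaloisLayerRep K E.1 (toDGM X)).V :=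
  AddMonoidHom.mk' (fun w => ⟨LCarrier.of X w.1, fun n =>
      congrArg (LCarrier.of X) (w.2 ⟨n, mem_coe_openNormalSubgroup_of_mem E n.2⟩)⟩) fun _ _ => rfl

/-- Unfolding. [cite: SerreGaloisCohomology1997, I §2.2] -/
@[simp] theorem toAbsLayerAddHom_apply_coe
    (w : ((invariantsQuotFunctor ℤ (E.openNormalSubgroup : Subgroup (absoluteGaloisGroup K))).obj X).V) :
    ((toAbsLayerAddHom E X w).1 : LCarrier X) = LCarrier.of X w.1 := rfl

/-- **The identity of vectors `X^{U_E} → (toDGM X)^{Γ_E}`** as a morphism of `Rep ℤ (Γ_K ⧸ Γ_E)` out of the restriction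
of door-c4's layer along `quotEquivAbs`. [cite: SerreGaloisCohomology1997, I §2.2 Proposition 8] -/
def toAbsLayerHom :
    Rep.res ((quotEquivAbs E).toMonoidHom)
        ((invariantsQuotFunctor ℤ (E.openNormalSubgroup : Subgroup (absoluteGaloisGroup K))).obj X) ⟶
      absGaloisLayerRep K E.1 (toDGM X) :=
  letI := ((invariantsQuotFunctor ℤ (E.openNormalSubgroup : Subgroup (absoluteGaloisGroup K))).obj X).hV2
  letI := (absGaloisLayerRep K E.1 (toDGM X)).hV2
  Rep.ofHom ⟨{ toFun := toAbsLayerAddHom E X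
               map_add' := fun w w' => map_add (toAbsLayerAddHom E X) w w'
               map_smul' := fun c w => by
                 simpa only [Int.cast_id, RingHom.id_apply] using map_intCast_smul (toAbsLayerAddHom E X) ℤ ℤ c w },
    fun g => by
      induction g using QuotientGroup.induction_on with
      | H σ => exact LinearMap.ext fun w => Subtype.ext rfl⟩

/-- Unfolding: `toAbsLayerHom` is the identity on underlying vectors. [cite: SerreGaloisCohomology1997, I §2.2] -/
@[simp] theorem toAbsLayerHom_apply_coe
    (w : ((invariantsQuotFunctor ℤ (E.openNormalSubgroup : Subgroup (absoluteGaloisGroup K))).obj X).V) :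
    (((toAbsLayerHom E X).hom w).1 : LCarrier X) = LCarrier.of X w.1 := rfl

/-- **`Hⁿ(Γ_K ⧸ U_E, X^{U_E}) → Hⁿ(Γ_K ⧸ Γ_E, (toDGM X)^{Γ_E})`** (Mathlib `groupCohomology.map` along `quotEquivAbs`,
`toAbsLayerHom`). [cite: SerreGaloisCohomology1997, I §2.2 Proposition 8] -/
def toAbsLayer (n : ℕ) :
    groupCohomology ((invariantsQuotFunctor ℤ (E.openNormalSubgroup : Subgroup (absoluteGaloisGroup K))).obj X) n ⟶
      groupCohomology (absGaloisLayerRep K E.1 (toDGM X)) n :=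
  groupCohomology.map (quotEquivAbs E).toMonoidHom (toAbsLayerHom E X) n

variable {M : Type} [AddCommGroup M] [TopologicalSpace M] [DiscreteTopology M] (ρ : DiscreteGaloisModule K M)

/-- The underlying additive map `M^{U_E} → M^{Γ_E}` for `X = ofDiscreteGaloisModule ρ` (identity of vectors, valued in
the GIVEN `M`). [cite: SerreGaloisCohomology1997, I §2.2] -/
def toAbsLayerAddHomOf :
    ((invariantsQuotFunctor ℤ (E.openNormalSubgroup : Subgroup (absoluteGaloisGroup K))).obj
        (ofDiscreteGaloisModule ρ)).V →+
      (absGaloisLayerRep K E.1 ρ).V :=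
  AddMonoidHom.mk' (fun w => ⟨(w.1 : M), fun n => w.2 ⟨n, mem_coe_openNormalSubgroup_of_mem E n.2⟩⟩) fun _ _ => rfl

/-- Unfolding. [cite: SerreGaloisCohomology1997, I §2.2] -/
@[simp] theorem toAbsLayerAddHomOf_apply_coe
    (w : ((invariantsQuotFunctor ℤ (E.openNormalSubgroup : Subgroup (absoluteGaloisGroup K))).obj
      (ofDiscreteGaloisModule ρ)).V) :
    ((toAbsLayerAddHomOf E ρ w).1 : M) = w.1 := rfl

/-- **The identity of vectors `M^{U_E} → M^{Γ_E}`** for `X = ofDiscreteGaloisModule ρ`, as a morphism of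
`Rep ℤ (Γ_K ⧸ Γ_E)`. [cite: SerreGaloisCohomology1997, I §2.2 Proposition 8] -/
def toAbsLayerHomOf :
    Rep.res ((quotEquivAbs E).toMonoidHom)
        ((invariantsQuotFunctor ℤ (E.openNormalSubgroup : Subgroup (absoluteGaloisGroup K))).obj
          (ofDiscreteGaloisModule ρ)) ⟶
      absGaloisLayerRep K E.1 ρ :=
  letI := ((invariantsQuotFunctor ℤ (E.openNormalSubgroup : Subgroup (absoluteGaloisGroup K))).obj
    (ofDiscreteGaloisModule ρ)).hV2
  letI := (absGaloisLayerRep K E.1 ρ).hV2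
  Rep.ofHom ⟨{ toFun := toAbsLayerAddHomOf E ρ
               map_add' := fun w w' => map_add (toAbsLayerAddHomOf E ρ) w w'
               map_smul' := fun c w => by
                 simpa only [Int.cast_id, RingHom.id_apply] using map_intCast_smul (toAbsLayerAddHomOf E ρ) ℤ ℤ c w },
    fun g => by
      induction g using QuotientGroup.induction_on with
      | H σ => exact LinearMap.ext fun w => Subtype.ext rfl⟩

/-- Unfolding: `toAbsLayerHomOf` is the identity on underlying vectors. [cite: SerreGaloisCohomology1997, I §2.2] -/
@[simp] theorem toAbsLayerHomOf_apply_coe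
    (w : ((invariantsQuotFunctor ℤ (E.openNormalSubgroup : Subgroup (absoluteGaloisGroup K))).obj
      (ofDiscreteGaloisModule ρ)).V) :
    (((toAbsLayerHomOf E ρ).hom w).1 : M) = w.1 := rfl

/-- **`Hⁿ(Γ_K ⧸ U_E, M^{U_E}) → Hⁿ(Γ_K ⧸ Γ_E, M^{Γ_E})`** for the given `ρ`. [cite: SerreGaloisCohomology1997, I §2.2 Proposition 8] -/
def toAbsLayerOf (n : ℕ) :
    groupCohomology ((invariantsQuotFunctor ℤ (E.openNormalSubgroup : Subgroup (absoluteGaloisGroup K))).obj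
        (ofDiscreteGaloisModule ρ)) n ⟶
      groupCohomology (absGaloisLayerRep K E.1 ρ) n :=
  groupCohomology.map (quotEquivAbs E).toMonoidHom (toAbsLayerHomOf E ρ) n

/-- Cocycle formula in degree `2`: `toAbsLayer E X 2 [b] = [(q, q') ↦ b(q, q')]`.
[cite: SerreGaloisCohomology1997, I §2.2 Proposition 8] -/
theorem toAbsLayer_H2π
    (b : cocycles₂ ((invariantsQuotFunctor ℤ (E.openNormalSubgroup : Subgroup (absoluteGaloisGroup K))).obj X)) :
    toAbsLayer E X 2 (H2π _ b) =
      H2π (absGaloisLayerRep K E.1 (toDGM X)) (mapCocycles₂ (quotEquivAbs E).toMonoidHom (toAbsLayerHom E X) b) :=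
  H2π_comp_map_apply (quotEquivAbs E).toMonoidHom (toAbsLayerHom E X) b

/-- Cocycle formula in degree `1`: `toAbsLayerOf E ρ 1 [γ] = [q ↦ γ q]`. [cite: SerreGaloisCohomology1997, I §2.2 Proposition 8] -/
theorem toAbsLayerOf_H1π
    (γ : cocycles₁ ((invariantsQuotFunctor ℤ (E.openNormalSubgroup : Subgroup (absoluteGaloisGroup K))).obj
      (ofDiscreteGaloisModule ρ))) :
    toAbsLayerOf E ρ 1 (H1π _ γ) =
      H1π (absGaloisLayerRep K E.1 ρ) (mapCocycles₁ (quotEquivAbs E).toMonoidHom (toAbsLayerHomOf E ρ) γ) :=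
  H1π_comp_map_apply (quotEquivAbs E).toMonoidHom (toAbsLayerHomOf E ρ) γ

end Transport


/-! ## §3. The connecting maps: door-c4's `δ_{S^{U_E}}` vs. the `LayerDelta` complex of the presentation -/

section Delta

variable [NumberField K]
variable {M : Type} [AddCommGroup M] [TopologicalSpace M] [DiscreteTopology M] [Finite M] (ρ : DiscreteGaloisModule K M)

/-- **`Γ_E` acts trivially on the presentation lattice `P`** for a layer `E ⊇ K(M)` (`U_{K(M)}` does, and
`Γ_E = U_E ≤ U_{K(M)}`). [cite: MilneADT2006, I Lemma 1.9 (proof)] -/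
theorem presModule₂_apply_eq_of_mem {E : GalLayer K} [Normal K E.1] (h : presentationLayer ρ ≤ E)
    (σ : absoluteGaloisGroup K) (hσ : σ ∈ absGaloisFixingSubgroup E.1) (m : LCarrier (presentationComplex ρ).X₂) :
    presModule₂ ρ σ m = m := by
  have hσ' : σ ∈ (presentationLayer ρ).openNormalSubgroup :=
    GalLayer.coe_openNormalSubgroup_le h (mem_coe_openNormalSubgroup_of_mem E hσ)
  rw [toDGM_apply]
  exact congrArg (LCarrier.of _) (trivialOn_presLattice (presentationLayer ρ) (presentationRank ρ) σ hσ' _)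

/-- **The `LayerDelta` complex of the canonical presentation at the layer `E`**:
`0 → N₁^{Γ_E} → P^{Γ_E} → M^{Γ_E} → 0` in `Rep ℤ (Γ_K ⧸ Γ_E)`. [cite: SerreGaloisCohomology1997, I §2.2 Proposition 8] -/
abbrev presLayerComplex (E : GalLayer K) [Normal K E.1] :
    ShortComplex (Rep ℤ (absoluteGaloisGroup K ⧸ absGaloisFixingSubgroup E.1)) :=
  layerComplex E.1 (presIncl ρ) (presProj ρ) (pres_isSES ρ)

/-- It is short exact for `E ⊇ K(M)`. [cite: SerreGaloisCohomology1997, I §2.2 Proposition 8] -/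
theorem presLayerComplex_shortExact {E : GalLayer K} [Normal K E.1] (h : presentationLayer ρ ≤ E) :
    (presLayerComplex ρ E).ShortExact :=
  layerComplex_shortExact E.1 (presIncl ρ) (presProj ρ) (pres_isSES ρ) (presModule₂_apply_eq_of_mem ρ h)

/-- **The transports as a morphism of short exact sequences of cochain complexes**
`C(Γ_K ⧸ U_E, S^{U_E}) ⟶ C(Γ_K ⧸ Γ_E, S^{Γ_E})` (componentwise `cochainsMap` along `quotEquivAbs`).
[cite: SerreGaloisCohomology1997, I §2.2 Proposition 8] -/
def cochainsTransport (E : GalLayer K) [Normal K E.1] :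
    ((presentationComplex ρ).map
        (invariantsQuotFunctor ℤ (E.openNormalSubgroup : Subgroup (absoluteGaloisGroup K)))).map
        (cochainsFunctor ℤ (absoluteGaloisGroup K ⧸ (E.openNormalSubgroup : Subgroup (absoluteGaloisGroup K)))) ⟶
      (presLayerComplex ρ E).map (cochainsFunctor ℤ (absoluteGaloisGroup K ⧸ absGaloisFixingSubgroup E.1)) where
  τ₁ := cochainsMap (quotEquivAbs E).toMonoidHom (toAbsLayerHom E (presentationComplex ρ).X₁)
  τ₂ := cochainsMap (quotEquivAbs E).toMonoidHom (toAbsLayerHom E (presentationComplex ρ).X₂)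
  τ₃ := cochainsMap (quotEquivAbs E).toMonoidHom (toAbsLayerHomOf E ρ)
  comm₁₂ := by
    change cochainsMap _ _ ≫ cochainsMap (MonoidHom.id _) _ = cochainsMap (MonoidHom.id _) _ ≫ cochainsMap _ _
    rw [← cochainsMap_comp, ← cochainsMap_comp]
    exact cochainsMap_congr (MonoidHom.ext fun _ => rfl) (DFunLike.ext _ _ fun w => Subtype.ext rfl)
  comm₂₃ := by
    change cochainsMap _ _ ≫ cochainsMap (MonoidHom.id _) _ = cochainsMap (MonoidHom.id _) _ ≫ cochainsMap _ _
    rw [← cochainsMap_comp, ← cochainsMap_comp]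
    exact cochainsMap_congr (MonoidHom.ext fun _ => rfl) (DFunLike.ext _ _ fun w => Subtype.ext rfl)

/-- **The transports commute with the connecting maps**:
`toAbsLayer E N₁ 2 (δ_{S^{U_E}} c) = δ_{S^{Γ_E}} (toAbsLayerOf E ρ 1 c)` (naturality of the connecting homomorphism of
the homology sequence, Mathlib `HomologySequence.δ_naturality`, for `cochainsTransport`).
[cite: SerreGaloisCohomology1997, I §2.2 Proposition 8][cite: NeukirchSchmidtWingberg2008, (1.5.1)] -/
theorem toAbsLayer_δ {E : GalLayer K} [Normal K E.1] (h : presentationLayer ρ ≤ E)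
    (c : groupCohomology ((invariantsQuotFunctor ℤ (E.openNormalSubgroup : Subgroup (absoluteGaloisGroup K))).obj
      (presentationComplex ρ).X₃) 1) :
    toAbsLayer E (presentationComplex ρ).X₁ 2
        (groupCohomology.δ (presentationComplex_map_invariantsQuotFunctor_shortExact ρ h) 1 2 rfl c) =
      groupCohomology.δ (presLayerComplex_shortExact ρ h) 1 2 rfl (toAbsLayerOf E ρ 1 c) := by
  have hnat := HomologicalComplex.HomologySequence.δ_naturality (cochainsTransport ρ E)
    (map_cochainsFunctor_shortExact (presentationComplex_map_invariantsQuotFunctor_shortExact ρ h))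
    (map_cochainsFunctor_shortExact (presLayerComplex_shortExact ρ h)) 1 2 rfl
  exact congrArg (fun T => (ConcreteCategory.hom T) c) hnat

/-! ## §4. (N2) in door-c4's currency -/

/-- **`δ₁^K (inf_E c) = inf_E (δ_{S^{U_E}} c)` in door-c4's currency**: for a layer `E ⊇ K(M)` and a layer class
`c ∈ H¹(Γ_K ⧸ U_E, M^{U_E})`, the native connecting map of the presentation applied to the inflation
`x := infOneLayer K E ρ (toAbsLayerOf E ρ 1 c) ∈ H¹(K, M)` is the inflation (`infTwo`) of the transported layer class
`toAbsLayer E N₁ 2 (δ_{S^{U_E}} c) ∈ H²(Γ_K ⧸ Γ_E, N₁^{Γ_E})` ((N2) `infTwo_δ_eq_δ₁_infOneLayer` + `toAbsLayer_δ`).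
[cite: SerreGaloisCohomology1997, I §2.2 Proposition 8][cite: NeukirchSchmidtWingberg2008, (1.5.1)] -/
theorem δ₁_infOneLayer_toAbsLayerOf [CompactSpace (absoluteGaloisGroup K)] {E : GalLayer K}
    [Normal K E.1] [FiniteDimensional K E.1] (h : presentationLayer ρ ≤ E)
    (c : groupCohomology ((invariantsQuotFunctor ℤ (E.openNormalSubgroup : Subgroup (absoluteGaloisGroup K))).obj
      (presentationComplex ρ).X₃) 1) :
    (pres_isSES ρ).δ₁ (infOneLayer K E.1 ρ (toAbsLayerOf E ρ 1 c)) =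
      infTwo K E.1 (presModule₁ ρ) (toAbsLayer E (presentationComplex ρ).X₁ 2
        (groupCohomology.δ (presentationComplex_map_invariantsQuotFunctor_shortExact ρ h) 1 2 rfl c)) := by
  rw [toAbsLayer_δ ρ h c]
  exact (infTwo_δ_eq_δ₁_infOneLayer E.1 (presIncl ρ) (presProj ρ) (pres_isSES ρ)
    (presModule₂_apply_eq_of_mem ρ h) (toAbsLayerOf E ρ 1 c)).symm

end Delta

end LayerDelta

end Literature.NumberTheory.GaloisRepresentations

end
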